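import Mathlib
import Summits.KontsevichZagierPeriods.KontsevichZagierPeriods.Theorems.SoloInformedLengthFaces
import Summits.KontsevichZagierPeriods.KontsevichZagierPeriods.Theorems.SoloInformedLengthFacesCatalan
import HarnessLib
import HarnessLib.Audit

/-!
# SoloInformed — monomial length faces: `ζ(5)/log⁵2`, `ζ(5)/(ζ(3) log²2)`, `ζ(3)/(G log 2)`, `G²/π⁴`

`SoloInformedLengthFaces` and `SoloInformedLengthFacesCatalan` recorded six faces of the
Kontsevich–Zagier conjecture which the residency's LENGTH invariant separates (paper, §3quater,
Theorem II‴).  The paper's sixth pass makes the inputs of that theorem unconditional in print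
(the cube pair `(𝔸ⁿ ∖ {1 + x₁⋯xₙ = 0}, ∂[0,1]ⁿ)` is the fibre at `z = −1` of the Dupont–Fresán
polylogarithm motive, arXiv:2305.00789, Def. 1.2, Thms. 3.3, 3.9) and proves a MONOMIAL RIGIDITY
statement (Proposition L′): in the ring of realised periods, two distinct monomials in
`⟦π⟧, log̃ 2, G̃, η̃(3), η̃(5), …` are never proportional over `ℚ`, because the unipotent radical of the
Tannaka group shifts each "primitive" generator by a non-zero rational multiple of `1̃` and fixes the
pure ones, so that iterating `u ↦ uʲ` turns a proportionality into a polynomial identity in `j` whose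
top coefficient is a non-zero product of additive characters.

This file records four further faces that Proposition L′ decides and that are expressible with the
sub-graph solids already in the tree (all in one cube each, by block products — Lemma K):

* **M1** (`LocRung₆`): `E_η(5)` against the log cube `Λ₅` — **`NoLocRel ↔ ζ(5)/(log 2)⁵ ∉ ℚ`**;
* **M2** (`LocRung₆`): `E_η(5)` against `E_η(3) ⊠ Λ₂ = E_{(1+x₀x₁x₂)(1+x₃)(1+x₄)}` (volume
  `(3/4) ζ(3) (log 2)²`) — **`NoLocRel ↔ ζ(5)/(ζ(3) (log 2)²) ∉ ℚ`**;
* **M3** (`LocRung₄`): `E_η(3)` against `E_G ⊠ Λ₁ = E_{(1+x₀²x₁²)(1+x₂)}` (volume `G log 2`) —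
  **`NoLocRel ↔ ζ(3)/(G log 2) ∉ ℚ`**;
* **M4** (`LocRung₅`): `E_G ⊠ E_G = E_{(1+x₀²x₁²)(1+x₂²x₃²)}` (volume `G²`) against
  `E_η(2) ⊠ E_η(2)` (volume `π⁴/144`) — **`NoLocRel ↔ G²/π⁴ ∉ ℚ`**, a face STRONGER than the parity
  face `G/π² ∉ ℚ` of `SoloInformedParityFaces` (`soloInformed_catalanOverPiSq_of_sq`).

All four irrationality statements are OPEN (the irrationality of `ζ(5)`, of `G`, of `ζ(3)/G` and any
polynomial relation between `π, log 2, G, ζ(3), ζ(5)` are open [Waldschmidt 2004, §3; Finch 2003,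
§§1.6–1.7]); each follows from Grothendieck's period conjecture for mixed Tate motives over
`ℤ[i, 1/2]`.  The kernel content is the exact equivalence at each rung and the volumes; the
`NoLocRel` statements themselves are proved in the paper (Proposition L′, Corollary II⁗).

Residency `solo-KontsevichZagierPeriods-informed` (PLAN.md, session s20).
References: M. Kontsevich, D. Zagier, *Periods* (2001), §1.2; C. Dupont, J. Fresán, *A construction
of the polylogarithm motive*, Épijournal Géom. Algébrique 9 (2025), arXiv:2305.00789, Def. 1.2,
Thm. 3.3, Thm. 3.9; Q. Wang, *Moduli spaces and multiple polylogarithm motives*, arXiv:math/0610670,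
Thm. 13; F. Brown, *Notes on motivic periods* (2017), §2.5 (arXiv:1512.06410); M. Waldschmidt, *Open
Diophantine problems*, Moscow Math. J. 4 (2004), §3; S. R. Finch, *Mathematical constants* (2003),
§§1.6, 1.7.
-/

noncomputable section

open MeasureTheory Set Filter
open scoped Topology

namespace Summit.KontsevichZagierPeriods.KontsevichZagierPeriods.Theorems

open Literature.NumberTheory.Transcendental Literature.NumberTheory.Transcendental.KZ

/-! ### Face M1 (`LocRung₆`): `E_η(5)` against the log cube `Λ₅` — `ζ(5)/(log 2)⁵` -/

/-- **`ζ(5)/(log 2)⁵ ∉ ℚ`** — OPEN (even `ζ(5) ∉ ℚ` is open) [Waldschmidt 2004, §3]. -/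
@[conjecture] def SoloInformedZetaFiveOverLogTwoFifthIrrational : Prop :=
  Irrational (zetaValue 5 / Real.log 2 ^ 5)

/-- **`NoLocRel(η₅, Λ₅)`**: no `N` and no positive `a, b` with `⟦[π]⟧ᴺ · ⟦a·[E_η(5)] − b·[Λ₅]⟧ = 0`,
where `E_η(5) = {t (1 + x₀⋯x₄) ≤ 1}` (volume `(15/16) ζ(5)`) and `Λ₅ = {t ∏(1+xᵢ) ≤ 1}` (volume
`(log 2)⁵`) are solids in `[0,1]⁶` (proved in the paper, Proposition L′: lengths `1 ≠ 5`; OPEN as a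
kernel statement). -/
@[conjecture] def SoloInformedEtaFiveLogFifthNoLocRelation : Prop :=
  ∀ N a b : ℕ, a ≠ 0 → b ≠ 0 →
    toFormalPeriod (of piRep) ^ N *
      toFormalPeriod (a • of (soloInformedEtaSolid 5) - b • of (soloInformedLogSolid 5)) ≠ 0

/-- `vol E_η(5) / vol Λ₅ ∉ ℚ ↔ ζ(5)/(log 2)⁵ ∉ ℚ` (the factor `15/16 ∈ ℚˣ`). -/
theorem soloInformed_faceM1_ratio_iff :
    Irrational ((soloInformedSubgraphRep (soloInformedEtaPoly 5) (soloInformed_etaPoly_ge_one 5)).value /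
        (soloInformedSubgraphRep (soloInformedLogPoly 5) (soloInformed_logPoly_ge_one 5)).value) ↔
      SoloInformedZetaFiveOverLogTwoFifthIrrational := by
  rw [soloInformed_value_etaSolid_five,
    show (soloInformedSubgraphRep (soloInformedLogPoly 5) (soloInformed_logPoly_ge_one 5)).value =
      Real.log 2 ^ 5 from soloInformed_value_logSolid 5]
  exact soloInformed_irrational_congr_ratMul (15 / 16 : ℚ) (by norm_num) (mul_div_assoc _ _ _)

/-- **Face M1: `LocRung₆ → (NoLocRel(η₅, Λ₅) ↔ ζ(5)/(log 2)⁵ ∉ ℚ)`.** -/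
theorem soloInformed_locRung_six_faceM1_iff (h : SoloInformedLocVolumeRung 6) :
    SoloInformedEtaFiveLogFifthNoLocRelation ↔ SoloInformedZetaFiveOverLogTwoFifthIrrational :=
  (soloInformed_locRung_subgraphNoLocRelation_iff (soloInformedEtaPoly 5) (soloInformedLogPoly 5)
    (soloInformed_etaPoly_ge_one 5) (soloInformed_logPoly_ge_one 5) h).trans soloInformed_faceM1_ratio_iff

/-- `Rung₆ → (NoLocRel(η₅, Λ₅) ↔ ζ(5)/(log 2)⁵ ∉ ℚ)`. -/
theorem soloInformed_rung_six_faceM1_iff (h : SoloInformedVolumeRung 6) :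
    SoloInformedEtaFiveLogFifthNoLocRelation ↔ SoloInformedZetaFiveOverLogTwoFifthIrrational :=
  soloInformed_locRung_six_faceM1_iff (soloInformed_locVolumeRung_of_volumeRung h)

/-- `ζ(5)/(log 2)⁵ ∉ ℚ → NoLocRel(η₅, Λ₅)`, unconditionally. -/
theorem soloInformed_faceM1_of_irrational (hirr : SoloInformedZetaFiveOverLogTwoFifthIrrational) :
    SoloInformedEtaFiveLogFifthNoLocRelation := fun N a b ha _ =>
  soloInformed_subgraphNoLocRelation_of_irrational _ _ _ _ (soloInformed_faceM1_ratio_iff.2 hirr) N a b ha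

/-! ### Face M2 (`LocRung₆`): `E_η(5)` against `E_η(3) ⊠ Λ₂` — `ζ(5)/(ζ(3) (log 2)²)` -/

/-- `(1 + x₀x₁x₂)(1 + x₃)(1 + x₄) ∈ ℚ[x₀, …, x₄]`. -/
def soloInformedEtaThreeLogSqPoly : MvPolynomial (Fin 5) ℚ :=
  soloInformedBlockMul (soloInformedEtaPoly 3) (soloInformedLogPoly 2)

/-- `(1 + x₀x₁x₂)(1 + x₃)(1 + x₄) ≥ 1` on the cube. -/
theorem soloInformed_etaThreeLogSqPoly_ge_one :
    ∀ x ∈ KZ.cube 5, (1 : ℝ) ≤ MvPolynomial.aeval x soloInformedEtaThreeLogSqPoly :=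
  soloInformed_blockMul_ge_one _ _ (soloInformed_etaPoly_ge_one 3) (soloInformed_logPoly_ge_one 2)

/-- **`E_η(3) ⊠ Λ₂ = {t (1+x₀x₁x₂)(1+x₃)(1+x₄) ≤ 1} ⊂ [0,1]⁶`**, volume `(3/4) ζ(3) (log 2)²`. -/
def soloInformedEtaThreeLogSqSolid : IntegralRep 6 :=
  soloInformedSubgraphRep soloInformedEtaThreeLogSqPoly soloInformed_etaThreeLogSqPoly_ge_one

/-- `vol (E_η(3) ⊠ Λ₂) = (3/4) ζ(3) · (log 2)²`. -/
theorem soloInformed_value_etaThreeLogSqSolid :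
    (soloInformedSubgraphRep soloInformedEtaThreeLogSqPoly soloInformed_etaThreeLogSqPoly_ge_one).value =
      ((3 / 4 : ℚ) : ℝ) * zetaValue 3 * Real.log 2 ^ 2 :=
  (soloInformed_value_blockRep (soloInformedEtaPoly 3) (soloInformedLogPoly 2)
    (soloInformed_etaPoly_ge_one 3) (soloInformed_logPoly_ge_one 2)).trans (by
      rw [soloInformed_value_etaSolid_three,
        show (soloInformedSubgraphRep (soloInformedLogPoly 2) (soloInformed_logPoly_ge_one 2)).value =
          Real.log 2 ^ 2 from soloInformed_value_logSolid 2])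

/-- `⟦E_η(3) ⊠ Λ₂⟧ = ⟦E_η(3)⟧ · ⟦Λ₂⟧` in `P` (Lemma K). -/
theorem soloInformed_toFormalPeriod_etaThreeLogSqSolid :
    toFormalPeriod (of soloInformedEtaThreeLogSqSolid) =
      toFormalPeriod (of (soloInformedEtaSolid 3)) * toFormalPeriod (of (soloInformedLogSolid 2)) :=
  (soloInformed_toFormalPeriod_blockRep (soloInformedEtaPoly 3) (soloInformedLogPoly 2)
    (soloInformed_etaPoly_ge_one 3) (soloInformed_logPoly_ge_one 2) soloInformed_etaThreeLogSqPoly_ge_one).symm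

/-- **`ζ(5)/(ζ(3) (log 2)²) ∉ ℚ`** — OPEN [Waldschmidt 2004, §3]. -/
@[conjecture] def SoloInformedZetaFiveOverZetaThreeLogTwoSqIrrational : Prop :=
  Irrational (zetaValue 5 / (zetaValue 3 * Real.log 2 ^ 2))

/-- **`NoLocRel(η₅, η₃ ⊠ Λ₂)`**: no `N` and no positive `a, b` with
`⟦[π]⟧ᴺ · ⟦a·[E_η(5)] − b·[E_η(3) ⊠ Λ₂]⟧ = 0` (solids in `[0,1]⁶`; proved in the paper, Proposition L′:
lengths `1 ≠ 3`; OPEN as a kernel statement). -/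
@[conjecture] def SoloInformedEtaFiveEtaThreeLogSqNoLocRelation : Prop :=
  ∀ N a b : ℕ, a ≠ 0 → b ≠ 0 →
    toFormalPeriod (of piRep) ^ N *
      toFormalPeriod (a • of (soloInformedEtaSolid 5) - b • of soloInformedEtaThreeLogSqSolid) ≠ 0

/-- `vol E_η(5) / vol (E_η(3) ⊠ Λ₂) ∉ ℚ ↔ ζ(5)/(ζ(3) (log 2)²) ∉ ℚ` (the factor `5/4 ∈ ℚˣ`). -/
theorem soloInformed_faceM2_ratio_iff :
    Irrational ((soloInformedSubgraphRep (soloInformedEtaPoly 5) (soloInformed_etaPoly_ge_one 5)).value /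
        (soloInformedSubgraphRep soloInformedEtaThreeLogSqPoly soloInformed_etaThreeLogSqPoly_ge_one).value) ↔
      SoloInformedZetaFiveOverZetaThreeLogTwoSqIrrational := by
  rw [soloInformed_value_etaSolid_five, soloInformed_value_etaThreeLogSqSolid]
  have hl : Real.log 2 ≠ 0 := (Real.log_pos one_lt_two).ne'
  have hζ : zetaValue 3 ≠ 0 := (soloInformed_zetaValue_pos (n := 3) (by norm_num)).ne'
  refine soloInformed_irrational_congr_ratMul (5 / 4 : ℚ) (by norm_num) ?_
  push_cast
  field_simp
  ring

/-- **Face M2: `LocRung₆ → (NoLocRel(η₅, η₃ ⊠ Λ₂) ↔ ζ(5)/(ζ(3) (log 2)²) ∉ ℚ)`.** -/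
theorem soloInformed_locRung_six_faceM2_iff (h : SoloInformedLocVolumeRung 6) :
    SoloInformedEtaFiveEtaThreeLogSqNoLocRelation ↔ SoloInformedZetaFiveOverZetaThreeLogTwoSqIrrational :=
  (soloInformed_locRung_subgraphNoLocRelation_iff (soloInformedEtaPoly 5) soloInformedEtaThreeLogSqPoly
    (soloInformed_etaPoly_ge_one 5) soloInformed_etaThreeLogSqPoly_ge_one h).trans
    soloInformed_faceM2_ratio_iff

/-- `Rung₆ → (NoLocRel(η₅, η₃ ⊠ Λ₂) ↔ ζ(5)/(ζ(3) (log 2)²) ∉ ℚ)`. -/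
theorem soloInformed_rung_six_faceM2_iff (h : SoloInformedVolumeRung 6) :
    SoloInformedEtaFiveEtaThreeLogSqNoLocRelation ↔ SoloInformedZetaFiveOverZetaThreeLogTwoSqIrrational :=
  soloInformed_locRung_six_faceM2_iff (soloInformed_locVolumeRung_of_volumeRung h)

/-- `ζ(5)/(ζ(3) (log 2)²) ∉ ℚ → NoLocRel(η₅, η₃ ⊠ Λ₂)`, unconditionally. -/
theorem soloInformed_faceM2_of_irrational (hirr : SoloInformedZetaFiveOverZetaThreeLogTwoSqIrrational) :
    SoloInformedEtaFiveEtaThreeLogSqNoLocRelation := fun N a b ha _ =>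
  soloInformed_subgraphNoLocRelation_of_irrational _ _ _ _ (soloInformed_faceM2_ratio_iff.2 hirr) N a b ha

/-- Face M2 in monomial form: `NoLocRel ↔ ∀ N, ∀ a b ≥ 1, ⟦π⟧ᴺ (a ⟦E_η(5)⟧ − b ⟦E_η(3)⟧⟦Λ₂⟧) ≠ 0`. -/
theorem soloInformed_faceM2_monomial_iff :
    SoloInformedEtaFiveEtaThreeLogSqNoLocRelation ↔
      ∀ N a b : ℕ, a ≠ 0 → b ≠ 0 →
        toFormalPeriod (of piRep) ^ N *
          (a • toFormalPeriod (of (soloInformedEtaSolid 5)) -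
            b • (toFormalPeriod (of (soloInformedEtaSolid 3)) *
              toFormalPeriod (of (soloInformedLogSolid 2)))) ≠ 0 := by
  simp only [SoloInformedEtaFiveEtaThreeLogSqNoLocRelation, map_sub, map_nsmul,
    soloInformed_toFormalPeriod_etaThreeLogSqSolid]

/-! ### Face M3 (`LocRung₄`): `E_η(3)` against `E_G ⊠ Λ₁` — `ζ(3)/(G log 2)` -/

/-- `(1 + x₀²x₁²)(1 + x₂) ∈ ℚ[x₀, x₁, x₂]`. -/
def soloInformedCatalanLogPoly : MvPolynomial (Fin 3) ℚ :=
  soloInformedBlockMul soloInformedCatalanPoly (soloInformedLogPoly 1)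

/-- `(1 + x₀²x₁²)(1 + x₂) ≥ 1` on the cube. -/
theorem soloInformed_catalanLogPoly_ge_one :
    ∀ x ∈ KZ.cube 3, (1 : ℝ) ≤ MvPolynomial.aeval x soloInformedCatalanLogPoly :=
  soloInformed_blockMul_ge_one _ _ soloInformed_catalanPoly_ge_one (soloInformed_logPoly_ge_one 1)

/-- **`E_G ⊠ Λ₁ = {t (1+x₀²x₁²)(1+x₂) ≤ 1} ⊂ [0,1]⁴`**, volume `G · log 2`. -/
def soloInformedCatalanLogSolid : IntegralRep 4 :=
  soloInformedSubgraphRep soloInformedCatalanLogPoly soloInformed_catalanLogPoly_ge_one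

/-- `vol (E_G ⊠ Λ₁) = G · log 2`. -/
theorem soloInformed_value_catalanLogSolid :
    (soloInformedSubgraphRep soloInformedCatalanLogPoly soloInformed_catalanLogPoly_ge_one).value =
      catalanConstant * Real.log 2 :=
  (soloInformed_value_blockRep soloInformedCatalanPoly (soloInformedLogPoly 1)
    soloInformed_catalanPoly_ge_one (soloInformed_logPoly_ge_one 1)).trans (by
      rw [show (soloInformedSubgraphRep soloInformedCatalanPoly soloInformed_catalanPoly_ge_one).value =
          catalanConstant from soloInformed_value_catalanSolid,
        show (soloInformedSubgraphRep (soloInformedLogPoly 1) (soloInformed_logPoly_ge_one 1)).value =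
          Real.log 2 ^ 1 from soloInformed_value_logSolid 1, pow_one])

/-- `⟦E_G ⊠ Λ₁⟧ = ⟦E_G⟧ · ⟦Λ₁⟧` in `P` (Lemma K). -/
theorem soloInformed_toFormalPeriod_catalanLogSolid :
    toFormalPeriod (of soloInformedCatalanLogSolid) =
      toFormalPeriod (of soloInformedCatalanSolid) * toFormalPeriod (of (soloInformedLogSolid 1)) :=
  (soloInformed_toFormalPeriod_blockRep soloInformedCatalanPoly (soloInformedLogPoly 1)
    soloInformed_catalanPoly_ge_one (soloInformed_logPoly_ge_one 1) soloInformed_catalanLogPoly_ge_one).symm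

/-- **`ζ(3)/(G log 2) ∉ ℚ`** — OPEN (nothing is known about the arithmetic nature of `ζ(3)/G`)
[Finch 2003, §§1.6, 1.7; Waldschmidt 2004, §3]. -/
@[conjecture] def SoloInformedZetaThreeOverCatalanLogTwoIrrational : Prop :=
  Irrational (zetaValue 3 / (catalanConstant * Real.log 2))

/-- **`NoLocRel(η₃, G ⊠ Λ₁)`**: no `N` and no positive `a, b` with
`⟦[π]⟧ᴺ · ⟦a·[E_η(3)] − b·[E_G ⊠ Λ₁]⟧ = 0` (solids in `[0,1]⁴`; proved in the paper, Proposition L′: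
lengths `1 ≠ 2`; OPEN as a kernel statement). -/
@[conjecture] def SoloInformedEtaThreeCatalanLogNoLocRelation : Prop :=
  ∀ N a b : ℕ, a ≠ 0 → b ≠ 0 →
    toFormalPeriod (of piRep) ^ N *
      toFormalPeriod (a • of (soloInformedEtaSolid 3) - b • of soloInformedCatalanLogSolid) ≠ 0

/-- `vol E_η(3) / vol (E_G ⊠ Λ₁) ∉ ℚ ↔ ζ(3)/(G log 2) ∉ ℚ` (the factor `3/4 ∈ ℚˣ`). -/
theorem soloInformed_faceM3_ratio_iff :
    Irrational ((soloInformedSubgraphRep (soloInformedEtaPoly 3) (soloInformed_etaPoly_ge_one 3)).value /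
        (soloInformedSubgraphRep soloInformedCatalanLogPoly soloInformed_catalanLogPoly_ge_one).value) ↔
      SoloInformedZetaThreeOverCatalanLogTwoIrrational := by
  rw [soloInformed_value_etaSolid_three, soloInformed_value_catalanLogSolid]
  exact soloInformed_irrational_congr_ratMul (3 / 4 : ℚ) (by norm_num) (mul_div_assoc _ _ _)

/-- **Face M3: `LocRung₄ → (NoLocRel(η₃, G ⊠ Λ₁) ↔ ζ(3)/(G log 2) ∉ ℚ)`.** -/
theorem soloInformed_locRung_four_faceM3_iff (h : SoloInformedLocVolumeRung 4) :
    SoloInformedEtaThreeCatalanLogNoLocRelation ↔ SoloInformedZetaThreeOverCatalanLogTwoIrrational :=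
  (soloInformed_locRung_subgraphNoLocRelation_iff (soloInformedEtaPoly 3) soloInformedCatalanLogPoly
    (soloInformed_etaPoly_ge_one 3) soloInformed_catalanLogPoly_ge_one h).trans soloInformed_faceM3_ratio_iff

/-- `Rung₄ → (NoLocRel(η₃, G ⊠ Λ₁) ↔ ζ(3)/(G log 2) ∉ ℚ)`. -/
theorem soloInformed_rung_four_faceM3_iff (h : SoloInformedVolumeRung 4) :
    SoloInformedEtaThreeCatalanLogNoLocRelation ↔ SoloInformedZetaThreeOverCatalanLogTwoIrrational :=
  soloInformed_locRung_four_faceM3_iff (soloInformed_locVolumeRung_of_volumeRung h)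

/-- `ζ(3)/(G log 2) ∉ ℚ → NoLocRel(η₃, G ⊠ Λ₁)`, unconditionally. -/
theorem soloInformed_faceM3_of_irrational (hirr : SoloInformedZetaThreeOverCatalanLogTwoIrrational) :
    SoloInformedEtaThreeCatalanLogNoLocRelation := fun N a b ha _ =>
  soloInformed_subgraphNoLocRelation_of_irrational _ _ _ _ (soloInformed_faceM3_ratio_iff.2 hirr) N a b ha

/-- Face M3 in monomial form: `NoLocRel ↔ ∀ N, ∀ a b ≥ 1, ⟦π⟧ᴺ (a ⟦E_η(3)⟧ − b ⟦E_G⟧⟦Λ₁⟧) ≠ 0`. -/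
theorem soloInformed_faceM3_monomial_iff :
    SoloInformedEtaThreeCatalanLogNoLocRelation ↔
      ∀ N a b : ℕ, a ≠ 0 → b ≠ 0 →
        toFormalPeriod (of piRep) ^ N *
          (a • toFormalPeriod (of (soloInformedEtaSolid 3)) -
            b • (toFormalPeriod (of soloInformedCatalanSolid) *
              toFormalPeriod (of (soloInformedLogSolid 1)))) ≠ 0 := by
  simp only [SoloInformedEtaThreeCatalanLogNoLocRelation, map_sub, map_nsmul,
    soloInformed_toFormalPeriod_catalanLogSolid]

/-! ### Face M4 (`LocRung₅`): `E_G ⊠ E_G` against `E_η(2) ⊠ E_η(2)` — `G²/π⁴` -/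

/-- `(1 + x₀²x₁²)(1 + x₂²x₃²) ∈ ℚ[x₀, …, x₃]`. -/
def soloInformedCatalanSqPoly : MvPolynomial (Fin 4) ℚ :=
  soloInformedBlockMul soloInformedCatalanPoly soloInformedCatalanPoly

/-- `(1 + x₀²x₁²)(1 + x₂²x₃²) ≥ 1` on the cube. -/
theorem soloInformed_catalanSqPoly_ge_one :
    ∀ x ∈ KZ.cube 4, (1 : ℝ) ≤ MvPolynomial.aeval x soloInformedCatalanSqPoly :=
  soloInformed_blockMul_ge_one _ _ soloInformed_catalanPoly_ge_one soloInformed_catalanPoly_ge_one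

/-- **`E_G ⊠ E_G = {t (1+x₀²x₁²)(1+x₂²x₃²) ≤ 1} ⊂ [0,1]⁵`**, volume `G²`. -/
def soloInformedCatalanSqSolid : IntegralRep 5 :=
  soloInformedSubgraphRep soloInformedCatalanSqPoly soloInformed_catalanSqPoly_ge_one

/-- `vol (E_G ⊠ E_G) = G · G`. -/
theorem soloInformed_value_catalanSqSolid :
    (soloInformedSubgraphRep soloInformedCatalanSqPoly soloInformed_catalanSqPoly_ge_one).value =
      catalanConstant * catalanConstant :=
  (soloInformed_value_blockRep soloInformedCatalanPoly soloInformedCatalanPoly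
    soloInformed_catalanPoly_ge_one soloInformed_catalanPoly_ge_one).trans (by
      rw [show (soloInformedSubgraphRep soloInformedCatalanPoly soloInformed_catalanPoly_ge_one).value =
          catalanConstant from soloInformed_value_catalanSolid])

/-- `⟦E_G ⊠ E_G⟧ = ⟦E_G⟧²` in `P` (Lemma K). -/
theorem soloInformed_toFormalPeriod_catalanSqSolid :
    toFormalPeriod (of soloInformedCatalanSqSolid) =
      toFormalPeriod (of soloInformedCatalanSolid) * toFormalPeriod (of soloInformedCatalanSolid) :=
  (soloInformed_toFormalPeriod_blockRep soloInformedCatalanPoly soloInformedCatalanPoly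
    soloInformed_catalanPoly_ge_one soloInformed_catalanPoly_ge_one soloInformed_catalanSqPoly_ge_one).symm

/-- **`G²/π⁴ ∉ ℚ`** — OPEN, and stronger than the open `G/π² ∉ ℚ` [Finch 2003, §1.7]. -/
@[conjecture] def SoloInformedCatalanSqOverPiFourthIrrational : Prop :=
  Irrational (catalanConstant ^ 2 / Real.pi ^ 4)

/-- **`NoLocRel(G ⊠ G, η₂ ⊠ η₂)`**: no `N` and no positive `a, b` with
`⟦[π]⟧ᴺ · ⟦a·[E_G ⊠ E_G] − b·[E_η(2) ⊠ E_η(2)]⟧ = 0` (solids in `[0,1]⁵` of volumes `G²` and `π⁴/144`;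
proved in the paper, Proposition L′: lengths `2 ≠ 0`; OPEN as a kernel statement). -/
@[conjecture] def SoloInformedCatalanSqEtaTwoSqNoLocRelation : Prop :=
  ∀ N a b : ℕ, a ≠ 0 → b ≠ 0 →
    toFormalPeriod (of piRep) ^ N *
      toFormalPeriod (a • of soloInformedCatalanSqSolid -
        b • of (soloInformedSubgraphRep soloInformedEtaTwoTwoPoly soloInformed_etaTwoTwoPoly_ge_one)) ≠ 0

/-- `vol (E_G ⊠ E_G) / vol (E_η(2) ⊠ E_η(2)) ∉ ℚ ↔ G²/π⁴ ∉ ℚ`. -/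
theorem soloInformed_faceM4_ratio_iff :
    Irrational ((soloInformedSubgraphRep soloInformedCatalanSqPoly soloInformed_catalanSqPoly_ge_one).value /
        (soloInformedSubgraphRep soloInformedEtaTwoTwoPoly soloInformed_etaTwoTwoPoly_ge_one).value) ↔
      SoloInformedCatalanSqOverPiFourthIrrational := by
  obtain ⟨q, hq0, hq⟩ := soloInformed_exists_rat_zetaValue_two
  rw [soloInformed_value_catalanSqSolid, soloInformed_value_etaTwoTwoSolid, hq]
  have hq' : (q : ℝ) ≠ 0 := by exact_mod_cast hq0
  have hπ : Real.pi ≠ 0 := Real.pi_pos.ne'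
  refine soloInformed_irrational_congr_ratMul (4 / q ^ 2 : ℚ) (by positivity) ?_
  push_cast
  field_simp
  ring

/-- **Face M4: `LocRung₅ → (NoLocRel(G ⊠ G, η₂ ⊠ η₂) ↔ G²/π⁴ ∉ ℚ)`.** -/
theorem soloInformed_locRung_five_faceM4_iff (h : SoloInformedLocVolumeRung 5) :
    SoloInformedCatalanSqEtaTwoSqNoLocRelation ↔ SoloInformedCatalanSqOverPiFourthIrrational :=
  (soloInformed_locRung_subgraphNoLocRelation_iff soloInformedCatalanSqPoly soloInformedEtaTwoTwoPoly
    soloInformed_catalanSqPoly_ge_one soloInformed_etaTwoTwoPoly_ge_one h).trans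
    soloInformed_faceM4_ratio_iff

/-- `Rung₅ → (NoLocRel(G ⊠ G, η₂ ⊠ η₂) ↔ G²/π⁴ ∉ ℚ)`. -/
theorem soloInformed_rung_five_faceM4_iff (h : SoloInformedVolumeRung 5) :
    SoloInformedCatalanSqEtaTwoSqNoLocRelation ↔ SoloInformedCatalanSqOverPiFourthIrrational :=
  soloInformed_locRung_five_faceM4_iff (soloInformed_locVolumeRung_of_volumeRung h)

/-- `G²/π⁴ ∉ ℚ → NoLocRel(G ⊠ G, η₂ ⊠ η₂)`, unconditionally. -/
theorem soloInformed_faceM4_of_irrational (hirr : SoloInformedCatalanSqOverPiFourthIrrational) :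
    SoloInformedCatalanSqEtaTwoSqNoLocRelation := fun N a b ha _ =>
  soloInformed_subgraphNoLocRelation_of_irrational _ _ _ _ (soloInformed_faceM4_ratio_iff.2 hirr) N a b ha

/-- `G²/π⁴ ∉ ℚ → G/π² ∉ ℚ`: face M4 dominates the parity face of `SoloInformedParityFaces`. -/
theorem soloInformed_catalanOverPiSq_of_sq (h : SoloInformedCatalanSqOverPiFourthIrrational) :
    SoloInformedCatalanOverPiSqIrrational := by
  refine Irrational.of_pow 2 ?_
  have e : (catalanConstant / Real.pi ^ 2) ^ 2 = catalanConstant ^ 2 / Real.pi ^ 4 := by ring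
  rw [e]
  exact h

/-! ### Under the conjecture -/

/-- **Four monomial faces of the Kontsevich–Zagier conjecture.**  Under `KontsevichZagierPeriods`
the no-certificate statements M1–M4 are EXACTLY the open irrationality statements
`ζ(5)/(log 2)⁵ ∉ ℚ`, `ζ(5)/(ζ(3)(log 2)²) ∉ ℚ`, `ζ(3)/(G log 2) ∉ ℚ`, `G²/π⁴ ∉ ℚ`. -/
theorem soloInformed_kz_lengthFacesMonomial (hKZ : KontsevichZagierPeriods) :
    (SoloInformedEtaFiveLogFifthNoLocRelation ↔ SoloInformedZetaFiveOverLogTwoFifthIrrational) ∧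
    (SoloInformedEtaFiveEtaThreeLogSqNoLocRelation ↔ SoloInformedZetaFiveOverZetaThreeLogTwoSqIrrational) ∧
    (SoloInformedEtaThreeCatalanLogNoLocRelation ↔ SoloInformedZetaThreeOverCatalanLogTwoIrrational) ∧
    (SoloInformedCatalanSqEtaTwoSqNoLocRelation ↔ SoloInformedCatalanSqOverPiFourthIrrational) :=
  ⟨soloInformed_locRung_six_faceM1_iff (soloInformed_locVolumeRung_of_kzp hKZ 6),
    soloInformed_locRung_six_faceM2_iff (soloInformed_locVolumeRung_of_kzp hKZ 6),
    soloInformed_locRung_four_faceM3_iff (soloInformed_locVolumeRung_of_kzp hKZ 4),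
    soloInformed_locRung_five_faceM4_iff (soloInformed_locVolumeRung_of_kzp hKZ 5)⟩

/-- **The conjecture predicts the four irrationality statements** as soon as the corresponding
no-certificate statements hold (which the paper proves, Proposition L′): `KZP ∧ NoLocRel(Mᵢ) → face Mᵢ`;
in particular `KZP ∧ NoLocRel(M4) → G/π² ∉ ℚ`. -/
theorem soloInformed_kz_lengthFacesMonomial_irrational (hKZ : KontsevichZagierPeriods)
    (h₁ : SoloInformedEtaFiveLogFifthNoLocRelation) (h₂ : SoloInformedEtaFiveEtaThreeLogSqNoLocRelation)
    (h₃ : SoloInformedEtaThreeCatalanLogNoLocRelation) (h₄ : SoloInformedCatalanSqEtaTwoSqNoLocRelation) :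
    SoloInformedZetaFiveOverLogTwoFifthIrrational ∧ SoloInformedZetaFiveOverZetaThreeLogTwoSqIrrational ∧
      SoloInformedZetaThreeOverCatalanLogTwoIrrational ∧ SoloInformedCatalanSqOverPiFourthIrrational ∧
      SoloInformedCatalanOverPiSqIrrational :=
  have e := soloInformed_kz_lengthFacesMonomial hKZ
  ⟨e.1.1 h₁, e.2.1.1 h₂, e.2.2.1.1 h₃, e.2.2.2.1 h₄, soloInformed_catalanOverPiSq_of_sq (e.2.2.2.1 h₄)⟩

end Summit.KontsevichZagierPeriods.KontsevichZagierPeriods.Theorems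

end
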